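import Literature.Computability.Cryptography.HallgrenTableRel
import Literature.Computability.Cryptography.HallgrenUnitBound
import Literature.Computability.Cryptography.PeriodFindingTableOracle
import HarnessLib

/-!
# Success analysis of Hallgren's algorithm in the tree's period-finding family, I: units and pairs

Topic `Computability/Cryptography`; the probabilistic half of the assembly of
`Hallgren2007_regulator_qsolvable_delim`, in the space of structured read-outs `γ` of the
input-reading period-finding family (law `unitLaw` of the unit tables `FuI` of the table-bit oracle
`tabLang (tabH q)`; `PeriodFindingInputFamily`, `PeriodFindingTableOracle`). Jozsa 2003, §10 Thm. 6:
each unit of block length `L ≥ 6n + 100` returns the rounded harmonic `round(kQ/S)` of the period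
`S = N·log ε` with probability `≥ 1/(5184 S)` (`prob_unit_ge`, from `HallgrenUnitBound.prob_cEst_harmonic_ge`
with the blurred table of `HallgrenTableRel`), two units give a coprime pair with probability
`≥ ε₀` (`prob_pairEv_ge`, `PeriodFindingTwoSamples.prob_twoSamples_ge`), and a coprime good pair makes
the post-processor correct (`result_of_goodR`, `HallgrenTrueCand.result_correct_of_goodPair`).
Theorem-and-definition file, no named facts.

## References

* R. Jozsa, arXiv:quant-ph/0302134 (2003), §10 (Thm. 6, Lemma 2, step (c)). [Jozsa2003]
* A. Yu. Kitaev, arXiv:quant-ph/9511026 (1995), §3. [Kitaev1995]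
-/

noncomputable section

open scoped Classical

namespace Literature.Computability.Cryptography

namespace HallgrenGiantStep

open _root_.Computability Literature.Computability.Complexity Literature.NumberTheory.QuadraticFields
  Literature.NumberTheory.QuadraticFields.QuadIrr PeriodFinding HallgrenPost Literature.Barriers.QuantumAdvantage
  Finset BlurredGapTable

variable (q : Polynomial ℕ) {x : List Bool} (hsf : Squarefree (decodeNat x)) (h2 : 2 ≤ decodeNat x)

/-! ### The data of the input in the family -/

/-- The core input `⟨x, ε⟩`. [folklore] -/
abbrev xs (x : List Bool) : List Bool := boolPair x []

omit hsf h2 in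
/-- Its length is `coreLen x`. [folklore] -/
theorem length_xs (x : List Bool) : (xs x).length = coreLen x := rfl

/-- The unit tables of the table-bit oracle of `tabH`. [cite: Jozsa2003, §10] -/
abbrev Ftab (x : List Bool) : Fin (nU (ofPoly q) (coreLen x)) → ℕ → List Bool :=
  FuI (spec (ofPoly q) (coreLen x)) (tabLang (tabH q)) (xs x)

/-- The block lengths of the units. [folklore] -/
abbrev Lu (x : List Bool) : Fin (nU (ofPoly q) (coreLen x)) → ℕ := (spec (ofPoly q) (coreLen x)).L

/-- The grid period `S = N · log ε`. [cite: Jozsa2003, §10 (S = NR)] -/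
def Sx : ℝ := (hallgrenW q).N x * (cycX q hsf h2).R

/-- The number of usable harmonics `K₀ = ⌊S/330⌋`. [cite: Jozsa2003, §10 (k ≤ K)] -/
def K0 : ℕ := ⌊Sx q hsf h2 / 330⌋₊

/-- The rounded `k`-th harmonic of unit `u`: `round(k Q_u / S)`. [cite: Jozsa2003, §10 (c_k)] -/
def ck (u : Fin (nU (ofPoly q) (coreLen x))) (k : ℕ) : ℕ := (round ((k : ℝ) * (Qof (Lu q x) u : ℝ) / Sx q hsf h2)).toNat

include hsf h2

/-! ### Numerics of the grid period -/

/-- `S ≥ 2^28 / 4` and `S > 0`. [folklore] -/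
theorem Sx_ge : (2 : ℝ) ^ 26 ≤ Sx q hsf h2 ∧ 0 < Sx q hsf h2 := by
  obtain ⟨hD, hD4⟩ := goodD_Dof hsf h2
  have hR4 : (1 : ℝ) / 4 < Real.log (fundUnit (Dx x)) := by
    have h := HallgrenRegulator.log_two_lt_two_mul_log_fundUnit hD hD4
    have h2l := Real.one_sub_inv_le_log_of_pos (by norm_num : (0 : ℝ) < 2)
    norm_num at h2l; linarith
  have hN := hallgrenW_N q x
  have hN28 : (2 : ℝ) ^ 28 ≤ (hallgrenW q).N x := by rw [hN]; exact pow_le_pow_right₀ (by norm_num) (by omega)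
  unfold Sx
  rw [show (cycX q hsf h2).R = Real.log (fundUnit (Dx x)) from rfl]
  constructor
  · have : (2 : ℝ) ^ 26 = 2 ^ 28 * (1 / 4) := by norm_num
    rw [this]
    exact mul_le_mul hN28 hR4.le (by norm_num) (by positivity)
  · have : (0 : ℝ) < (hallgrenW q).N x := by linarith [pow_pos (show (0 : ℝ) < 2 by norm_num) 28]
    exact mul_pos this (by linarith)

/-! ### The per-unit bound -/

omit hsf h2 in
/-- The block length of a unit. [folklore] -/
theorem Lu_eq (u : Fin (nU (ofPoly q) (coreLen x))) : Lu q x u = LofC q (coreLen x) u := by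
  show (spec (ofPoly q) (coreLen x)).L u = _
  rw [spec_L, LofC_eq q u.isLt]

omit hsf h2 in
/-- Block lengths are below the depth of the walk. [folklore] -/
theorem Lu_le_Tx (u : Fin (nU (ofPoly q) (coreLen x))) : Lu q x u ≤ Tx q x := by
  have h : Lu q x u = LofC q (coreLen x) u := by show (spec (ofPoly q) (coreLen x)).L u = _; rw [spec_L, LofC_eq q u.isLt]
  rw [h]; unfold LofC Tx
  have := min_le_right ((u : ℕ) / 12) (q.eval (coreLen x))
  omega

/-- **The unit table realises the blurred table**: hypothesis `hrel` of the per-unit bound. [cite: Jozsa2003, §10 Prop. 36] -/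
theorem hrel (u : Fin (nU (ofPoly q) (coreLen x))) (hLmin : (hallgrenW q).Lmin (coreLen x) ≤ Lu q x u) :
    ∀ v < Qof (Lu q x) u, ∀ v' < Qof (Lu q x) u,
      (Ftab q x u v = Ftab q x u v' ↔ (blurredL q hsf h2 (Lu_le_Tx q u)).FN v = (blurredL q hsf h2 (Lu_le_Tx q u)).FN v') := by
  intro v hv v' hv'
  rw [Qof] at hv hv'
  have hlen : ∀ w, (tabH q x w).length < (spec (ofPoly q) (xs x).length).L u := by
    intro w; rw [length_tabH]; show 5 * x.length + 52 < Lu q x u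
    have : (hallgrenW q).Lmin (coreLen x) = 6 * coreLen x + 100 := rfl
    rw [this, coreLen_eq] at hLmin; omega
  rw [← tabH_eq_iff q hsf h2 (Lu_le_Tx q u) hv hv']
  exact FuI_tabLang_inj (tabH q) (ofPoly q) x u hv hv' (hlen v) (hlen v')

/-- **The blur of the input's table is tiny**: `e = N·E_tot ≤ 2⁻¹²`, `w = e + 1`. [cite: Jozsa2003, §9 Thm. 5] -/
theorem blur_small {L : ℕ} (hL : L ≤ Tx q x) :
    (blurredL q hsf h2 hL).S = Sx q hsf h2 ∧ (blurredL q hsf h2 hL).w = (blurredL q hsf h2 hL).e + 1 ∧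
      0 ≤ (blurredL q hsf h2 hL).e ∧ (blurredL q hsf h2 hL).e ≤ 1 / 4096 ∧
        (blurredL q hsf h2 hL).n = periodLength (Dx x) := by
  obtain ⟨hD, hD4⟩ := goodD_Dof hsf h2
  set C := cycX q hsf h2 with hC
  have he : (blurredL q hsf h2 hL).e = (hallgrenW q).N x * C.Etot (s0Of (Dx x)) (Tx q x) (2 * MOf (Dx x) (Tx q x)) := rfl
  refine ⟨rfl, rfl, ?_, ?_, rfl⟩
  · rw [he]
    refine mul_nonneg (Nat.cast_nonneg _) ?_
    unfold GiantStepCycle.Etot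
    have := C.Edesc_nonneg (s0Of (Dx x)) (Tx q x) 0
    have := C.η_nonneg
    positivity
  · rw [he]
    have hbud := Efin_budget hD hD4 (Tx q x) (2 * x.length + 30)
    have hη := C.η_nonneg
    have hEt : C.Etot (s0Of (Dx x)) (Tx q x) (2 * MOf (Dx x) (Tx q x)) ≤ 1 / (1024 * (2 : ℝ) ^ (2 * x.length + 30)) := by
      refine le_trans ?_ hbud
      show C.Etot _ _ _ ≤ C.Efin _ _ _ + 2 * C.η
      unfold GiantStepCycle.Etot GiantStepCycle.Efin; push_cast; linarith
    rw [hallgrenW_N q x]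
    have h2j : (2 : ℝ) ^ (2 * x.length + 30) = (2 : ℝ) ^ (2 * x.length + 28) * 4 := by
      rw [show 2 * x.length + 30 = (2 * x.length + 28) + 2 from rfl, pow_add]; norm_num
    rw [h2j] at hEt
    set A := (2 : ℝ) ^ (2 * x.length + 28) with hA
    have hA0 : 0 < A := by rw [hA]; positivity
    calc A * C.Etot (s0Of (Dx x)) (Tx q x) (2 * MOf (Dx x) (Tx q x)) ≤ A * (1 / (1024 * (A * 4))) :=
          mul_le_mul_of_nonneg_left hEt hA0.le
      _ = 1 / 4096 := by field_simp; ring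

/-- **Many good starts**: `#goodStarts ≥ S/2`. [cite: Jozsa2003, §10 Prop. 36 (iii)] -/
theorem goodStarts_ge {L : ℕ} (hL : L ≤ Tx q x) : Sx q hsf h2 / 2 ≤ ((blurredL q hsf h2 hL).goodStarts.card : ℝ) := by
  obtain ⟨hD, hD4⟩ := goodD_Dof hsf h2
  set T := blurredL q hsf h2 hL with hT
  obtain ⟨hS, hw, he0, he, hn⟩ := blur_small q hsf h2 hL
  obtain ⟨hS26, hSpos⟩ := Sx_ge q hsf h2
  have hcard := T.card_goodStarts_ge
  rw [hS, hw, hn] at hcard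
  -- `B ∈ [S − 2w − 1, S − 2w]`
  have hB1 : (T.B : ℝ) ≤ Sx q hsf h2 := by
    have : (T.B : ℝ) ≤ T.S - 2 * T.w := Nat.floor_le (by rw [hS, hw]; linarith)
    rw [hS, hw] at this; linarith
  have hB2 : Sx q hsf h2 - 2 * (T.e + 1) - 1 ≤ T.B := by
    have := Nat.lt_floor_add_one (T.S - 2 * T.w)
    rw [hS, hw] at this
    have : (T.B : ℝ) = ⌊Sx q hsf h2 - 2 * (T.e + 1)⌋₊ := rfl
    linarith [Nat.lt_floor_add_one (Sx q hsf h2 - 2 * (T.e + 1))]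
  -- the period length is small against `S`
  have hp := periodLength_le hD hD4
  have h2l : (1 : ℝ) / 2 ≤ Real.log 2 := by
    have := Real.one_sub_inv_le_log_of_pos (by norm_num : (0 : ℝ) < 2); norm_num at this; linarith
  have hR0 : 0 < Real.log (fundUnit (Dx x)) := Real.log_pos (one_lt_fundUnit hD hD4)
  have hp4 : (periodLength (Dx x) : ℝ) ≤ 4 * Real.log (fundUnit (Dx x)) + 1 := by
    have : 2 * Real.log (fundUnit (Dx x)) / Real.log 2 ≤ 4 * Real.log (fundUnit (Dx x)) := by
      rw [div_le_iff₀ (by linarith)]; nlinarith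
    linarith
  have hSR : Sx q hsf h2 = (hallgrenW q).N x * Real.log (fundUnit (Dx x)) := rfl
  have hN : (2 : ℝ) ^ 28 ≤ (hallgrenW q).N x := by rw [hallgrenW_N q x]; exact pow_le_pow_right₀ (by norm_num) (by omega)
  have hpS : 64 * (periodLength (Dx x) : ℝ) ≤ Sx q hsf h2 / 4 := by
    rw [hSR]
    have : 64 * (4 * Real.log (fundUnit (Dx x)) + 1) ≤ (2 : ℝ) ^ 28 * Real.log (fundUnit (Dx x)) / 4 := by
      -- `256 R + 64 ≤ 2^26 R` as `R > 1/4`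
      have hR4 : (1 : ℝ) / 4 < Real.log (fundUnit (Dx x)) := by
        have h := HallgrenRegulator.log_two_lt_two_mul_log_fundUnit hD hD4; linarith
      nlinarith
    have h' : (2 : ℝ) ^ 28 * Real.log (fundUnit (Dx x)) / 4 ≤ (hallgrenW q).N x * Real.log (fundUnit (Dx x)) / 4 := by
      apply div_le_div_of_nonneg_right _ (by norm_num); exact mul_le_mul_of_nonneg_right hN hR0.le
    linarith
  -- assemble
  have hfac1 : ((T.B : ℝ) + 2 * (2 * (T.e + 1) + T.e)) / Sx q hsf h2 + 1 ≤ 3 := by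
    have : ((T.B : ℝ) + 2 * (2 * (T.e + 1) + T.e)) ≤ 2 * Sx q hsf h2 := by nlinarith
    rw [div_add_one hSpos.ne', div_le_iff₀ hSpos]; linarith
  have hfac2 : (2 * (2 * (T.e + 1) + T.e) + 1 : ℝ) ≤ 6 := by linarith
  have hn0 : (0 : ℝ) ≤ periodLength (Dx x) := Nat.cast_nonneg _
  have hprod : (periodLength (Dx x) : ℝ) * (((T.B : ℝ) + 2 * (2 * (T.e + 1) + T.e)) / Sx q hsf h2 + 1) *
      (2 * (2 * (T.e + 1) + T.e) + 1) ≤ periodLength (Dx x) * 3 * 6 := by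
    have h0 : 0 ≤ ((T.B : ℝ) + 2 * (2 * (T.e + 1) + T.e)) / Sx q hsf h2 + 1 := by positivity
    exact mul_le_mul (mul_le_mul_of_nonneg_left hfac1 hn0) hfac2 (by positivity) (by positivity)
  linarith

/-- **The per-unit probability of the `k`-th rounded harmonic** (`1 ≤ k ≤ K₀`, block length `≥ Lmin`):
at least `1/(5184 S)`. [cite: Jozsa2003, §10 Thm. 6] [cite: Kitaev1995, §3] -/
theorem prob_unit_ge (u : Fin (nU (ofPoly q) (coreLen x))) (hLmin : (hallgrenW q).Lmin (coreLen x) ≤ Lu q x u)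
    {k : ℕ} (hk1 : 1 ≤ k) (hk : k ≤ K0 q hsf h2) :
    1 / (5184 * Sx q hsf h2) ≤ prob (X := fun _ : Fin (nU (ofPoly q) (coreLen x)) => TIdx (Lv (ofPoly q) (coreLen x)) (Bn (ofPoly q) (coreLen x)) → Bool)
      (unitLaw (Lu q x) (Ftab q x)) (univ.filter fun γ => cEst (Qof (Lu q x) u) (γ u) = ck q hsf h2 u k) := by
  obtain ⟨hD, hD4⟩ := goodD_Dof hsf h2
  set T := blurredL q hsf h2 (Lu_le_Tx q u) with hT
  obtain ⟨hS, hw, he0, he, -⟩ := blur_small q hsf h2 (Lu_le_Tx q u)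
  obtain ⟨hS26, hSpos⟩ := Sx_ge q hsf h2
  set S := Sx q hsf h2 with hSdef
  set Q : ℕ := Qof (Lu q x) u with hQdef
  have hQpow : Q = 2 ^ Lu q x u := rfl
  -- `Q ≥ 3S²`
  have hLmin' : 6 * coreLen x + 100 ≤ Lu q x u := hLmin
  have hQ3 : 3 * S ^ 2 ≤ (Q : ℝ) := by
    have := three_S_sq_le (d := decodeNat x) hsf h2 q rfl hLmin'
    rw [hQpow]; exact this
  have hS1 : (1 : ℝ) ≤ S := le_trans (by norm_num) hS26
  have hQS : 3 * S ≤ (Q : ℝ) := le_trans (by nlinarith) hQ3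
  have hQpos : (0 : ℝ) < Q := by linarith
  have hw2 : 2 * T.w + 1 ≤ 4 := by rw [hw]; linarith
  have hw0 : 0 ≤ 2 * T.w + 1 := by rw [hw]; linarith
  -- `k` is a usable harmonic
  have hK0 : (K0 q hsf h2 : ℝ) ≤ S / 330 := Nat.floor_le (by positivity)
  have hkS : 330 * (k : ℝ) ≤ S := by
    have : (k : ℝ) ≤ K0 q hsf h2 := by exact_mod_cast hk
    linarith
  -- the rounded harmonic
  set z : ℝ := (k : ℝ) * Q / S with hz
  have hz0 : 0 ≤ z := by positivity
  have hzQ : z ≤ (Q : ℝ) / 330 := by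
    rw [hz, div_le_div_iff₀ hSpos (by norm_num)]; nlinarith
  have hround0 : 0 ≤ round z := by
    have := abs_sub_round z; rw [abs_le] at this
    have : (-1 : ℝ) < round z := by linarith
    exact_mod_cast (show (-1 : ℤ) < round z by exact_mod_cast this)
  have hck : (ck q hsf h2 u k : ℝ) = round z := by
    have : ((round z).toNat : ℤ) = round z := Int.toNat_of_nonneg hround0
    show (((round ((k : ℝ) * (Q : ℝ) / S)).toNat : ℕ) : ℝ) = round z
    rw [← hz]
    exact_mod_cast this
  have hc : |(ck q hsf h2 u k : ℝ) - k * (Q : ℝ) / T.S| ≤ 1 / 2 := by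
    rw [hS, hck, ← hz, abs_sub_comm]; exact abs_sub_round z
  have hcQ : ck q hsf h2 u k < Q := by
    have : (ck q hsf h2 u k : ℝ) < Q := by
      rw [hck]; have := abs_sub_round z; rw [abs_le] at this; nlinarith
    exact_mod_cast this
  -- the generic bound
  have hη : 0 ≤ 1 - ηacc (Lv (ofPoly q) (coreLen x)) (Bn (ofPoly q) (coreLen x)) := by
    have := ηacc_le (ofPoly q) (coreLen x); linarith
  have hgen := prob_cEst_harmonic_ge (Lu q x) (Ftab q x) T (Bn_pos (ofPoly q) (coreLen x)) (Lv_pos (ofPoly q) (coreLen x))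
    (Qof_le_Lv (ofPoly q) (coreLen x) u) hcQ (hrel q hsf h2 u hLmin) (by rw [hS]; exact hS1)
    (by show 100 * (2 * T.w + 1) ≤ (Q : ℝ); nlinarith)
    (by rw [hS]; show 5 * S + 5 * (2 * T.w + 1) ≤ (Q : ℝ); nlinarith)
    (k := k) (by rw [hS]; nlinarith) hc hη
  rw [← hQdef] at hgen
  refine le_trans ?_ hgen
  -- numerics: `(1 − ηacc) ≥ 1/2`, `#goodStarts ≥ S/2`, `((⌊Q/S⌋ − 1)/12)²/Q² ≥ 1/(1296 S²)`
  have hη2 : (1 : ℝ) / 2 ≤ 1 - ηacc (Lv (ofPoly q) (coreLen x)) (Bn (ofPoly q) (coreLen x)) := by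
    have := ηacc_le (ofPoly q) (coreLen x); linarith
  have hgs := goodStarts_ge q hsf h2 (Lu_le_Tx q u)
  rw [← hT] at hgs
  have hfl : S ⁻¹ * Q / 3 ≤ (((⌊(Q : ℝ) / T.S⌋₊ - 1 : ℕ) : ℝ)) := by
    rw [hS]
    have h1 : (1 : ℕ) ≤ ⌊(Q : ℝ) / S⌋₊ := by
      rw [Nat.one_le_floor_iff, le_div_iff₀ hSpos]; linarith
    have h2' : (((⌊(Q : ℝ) / S⌋₊ - 1 : ℕ) : ℝ)) = (⌊(Q : ℝ) / S⌋₊ : ℝ) - 1 := by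
      rw [Nat.cast_sub h1]; simp
    rw [h2']
    have h3 := Nat.lt_floor_add_one ((Q : ℝ) / S)
    have h4 : S⁻¹ * Q = (Q : ℝ) / S := by rw [div_eq_inv_mul]
    rw [h4]
    have h5 : (Q : ℝ) / S ≥ 3 := by rw [ge_iff_le, le_div_iff₀ hSpos]; linarith
    linarith
  have hterm : 1 / (1296 * S ^ 2) ≤ (((⌊(Q : ℝ) / T.S⌋₊ - 1 : ℕ) : ℝ) / 12) ^ 2 / ((Q : ℝ) ^ 2) := by
    rw [div_pow, div_div, le_div_iff₀ (by positivity)]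
    have h0 : 0 ≤ S⁻¹ * Q / 3 := by positivity
    have := pow_le_pow_left₀ h0 hfl 2
    have hSi : S⁻¹ * S = 1 := inv_mul_cancel₀ hSpos.ne'
    calc 1 / (1296 * S ^ 2) * ((12 : ℝ) ^ 2 * (Q : ℝ) ^ 2) = (S⁻¹ * Q / 3) ^ 2 := by field_simp; ring
      _ ≤ _ := this
  calc 1 / (5184 * S) = (1 / 2) * ((S / 2) * (1 / (1296 * S ^ 2))) := by field_simp; ring
    _ ≤ (1 - ηacc (Lv (ofPoly q) (coreLen x)) (Bn (ofPoly q) (coreLen x))) *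
        ((T.goodStarts.card : ℝ) * ((((⌊(Q : ℝ) / T.S⌋₊ - 1 : ℕ) : ℝ) / 12) ^ 2 / ((Q : ℝ) ^ 2))) := by
        apply mul_le_mul hη2 _ (by positivity) (by linarith)
        exact mul_le_mul hgs hterm (by positivity) (by positivity)
    _ = _ := by ring

/-! ### The rounded harmonics -/

/-- **The rounded harmonic**: `c_k = round(kQ/S) ≥ 0`, within `1/2` of `kQ/S`, below `Q`, for `k ≤ K₀`
on a usable unit. [cite: Jozsa2003, §10 (c_k)] -/
theorem ck_spec (u : Fin (nU (ofPoly q) (coreLen x))) (hLmin : (hallgrenW q).Lmin (coreLen x) ≤ Lu q x u)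
    {k : ℕ} (hk : k ≤ K0 q hsf h2) :
    (ck q hsf h2 u k : ℝ) = round ((k : ℝ) * (Qof (Lu q x) u : ℝ) / Sx q hsf h2) ∧
      |(ck q hsf h2 u k : ℝ) - k * (Qof (Lu q x) u : ℝ) / Sx q hsf h2| ≤ 1 / 2 ∧ ck q hsf h2 u k < Qof (Lu q x) u ∧
        3 * Sx q hsf h2 ≤ Qof (Lu q x) u := by
  obtain ⟨hS26, hSpos⟩ := Sx_ge q hsf h2
  set S := Sx q hsf h2 with hSdef
  set Q : ℕ := Qof (Lu q x) u with hQdef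
  have hLmin' : 6 * coreLen x + 100 ≤ Lu q x u := hLmin
  have hQ3 : 3 * S ^ 2 ≤ (Q : ℝ) := three_S_sq_le (d := decodeNat x) hsf h2 q rfl hLmin'
  have hS1 : (1 : ℝ) ≤ S := le_trans (by norm_num) hS26
  have hQS : 3 * S ≤ (Q : ℝ) := le_trans (by nlinarith) hQ3
  have hK0 : (K0 q hsf h2 : ℝ) ≤ S / 330 := Nat.floor_le (by positivity)
  have hkS : 330 * (k : ℝ) ≤ S := by
    have : (k : ℝ) ≤ K0 q hsf h2 := by exact_mod_cast hk
    linarith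
  set z : ℝ := (k : ℝ) * (Q : ℝ) / S with hz
  have hz0 : 0 ≤ z := by positivity
  have hzQ : z ≤ (Q : ℝ) / 330 := by
    rw [hz, div_le_div_iff₀ hSpos (by norm_num)]
    have : (0 : ℝ) ≤ Q := by positivity
    nlinarith
  have hround0 : 0 ≤ round z := by
    have := abs_sub_round z; rw [abs_le] at this
    have : (-1 : ℝ) < round z := by linarith
    exact_mod_cast (show (-1 : ℤ) < round z by exact_mod_cast this)
  have hck : (ck q hsf h2 u k : ℝ) = round z := by
    have : ((round z).toNat : ℤ) = round z := Int.toNat_of_nonneg hround0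
    show (((round ((k : ℝ) * (Q : ℝ) / S)).toNat : ℕ) : ℝ) = round z
    rw [← hz]
    exact_mod_cast this
  refine ⟨hck, ?_, ?_, hQS⟩
  · rw [hck, abs_sub_comm]; exact abs_sub_round z
  · have : (ck q hsf h2 u k : ℝ) < Q := by
      rw [hck]; have := abs_sub_round z; rw [abs_le] at this
      have hQ0 : (0 : ℝ) < Q := by linarith
      nlinarith
    exact_mod_cast this

/-- **Rounded harmonics are one-to-one** on `1 ≤ k ≤ K₀` (pitch `Q/S ≥ 3`). [cite: Jozsa2003, §10] -/
theorem ck_injOn (u : Fin (nU (ofPoly q) (coreLen x))) (hLmin : (hallgrenW q).Lmin (coreLen x) ≤ Lu q x u) :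
    Set.InjOn (ck q hsf h2 u) (Icc 1 (K0 q hsf h2) : Finset ℕ) := by
  intro k hk k' hk' h
  have hkK : k ≤ K0 q hsf h2 := (mem_Icc.1 hk).2
  have hkK' : k' ≤ K0 q hsf h2 := (mem_Icc.1 hk').2
  obtain ⟨e1, -, -, hQS⟩ := ck_spec q hsf h2 u hLmin hkK
  obtain ⟨e2, -, -, -⟩ := ck_spec q hsf h2 u hLmin hkK'
  obtain ⟨-, hSpos⟩ := Sx_ge q hsf h2
  have hr : (round ((k : ℝ) * (Qof (Lu q x) u : ℝ) / Sx q hsf h2) : ℝ) = round ((k' : ℝ) * (Qof (Lu q x) u : ℝ) / Sx q hsf h2) := by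
    rw [← e1, ← e2]; exact_mod_cast h
  have hinj := round_harmonic_injective (Q := Qof (Lu q x) u) hSpos (by linarith)
  exact hinj (by exact_mod_cast hr)

/-! ### Pairs of units -/

/-- Pair indices: a block length and a trial slot. [folklore] -/
abbrev PIdx (x : List Bool) : Type := Fin (nL (ofPoly q) (coreLen x)) × Fin 6

/-- First unit of pair `i`. [folklore] -/
def aI (i : PIdx q x) : Fin (nU (ofPoly q) (coreLen x)) := (eU (ofPoly q) (coreLen x)).symm (i.1, (0 : Fin 2), i.2)

/-- Second unit of pair `i`. [folklore] -/
def bI (i : PIdx q x) : Fin (nU (ofPoly q) (coreLen x)) := (eU (ofPoly q) (coreLen x)).symm (i.1, (1 : Fin 2), i.2)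

omit hsf h2 in
/-- The pairs are disjoint. [folklore] -/
theorem disjointPairs : DisjointPairs (aI q (x := x)) (bI q (x := x)) where
  inj_a := fun i j h => by
    have := (eU (ofPoly q) (coreLen x)).symm.injective h
    simp only [Prod.mk.injEq] at this
    exact Prod.ext this.1 this.2.2
  inj_b := fun i j h => by
    have := (eU (ofPoly q) (coreLen x)).symm.injective h
    simp only [Prod.mk.injEq] at this
    exact Prod.ext this.1 this.2.2
  a_ne_b := fun i j h => by
    have := (eU (ofPoly q) (coreLen x)).symm.injective h
    simp only [Prod.mk.injEq] at this
    exact absurd this.2.1 (by decide)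

omit hsf h2 in
/-- The block lengths of a pair: both `n + li`. [folklore] -/
theorem Lu_pair (i : PIdx q x) : Lu q x (aI q i) = coreLen x + i.1 ∧ Lu q x (bI q i) = coreLen x + i.1 := by
  have key : ∀ u : Fin (nU (ofPoly q) (coreLen x)), Lu q x u = coreLen x + ((eU (ofPoly q) (coreLen x) u).1 : ℕ) := by
    intro u
    show (spec (ofPoly q) (coreLen x)).L u = _
    rw [spec_L]; unfold LofN; rw [val_eU_fst]
  constructor
  · rw [key]; unfold aI; rw [Equiv.apply_symm_apply]
  · rw [key]; unfold bI; rw [Equiv.apply_symm_apply]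

/-- **Usable pairs**: block length at least `Lmin`. [folklore] -/
def usable : Finset (PIdx q x) := univ.filter fun i => (hallgrenW q).Lmin (coreLen x) ≤ coreLen x + i.1

/-- **The pair event**: the two units carry the rounded harmonics of a coprime pair `k, l ≤ K₀`.
(Stated in the shape of `PeriodFinding.prob_twoSamples_ge`.) [cite: Jozsa2003, §10 Thm. 6 (gcd(k, l) = 1)] -/
def PairEv (i : PIdx q x) (γa γb : TIdx (Lv (ofPoly q) (coreLen x)) (Bn (ofPoly q) (coreLen x)) → Bool) : Prop :=
  ∃ kk ∈ ((Icc 1 (K0 q hsf h2)) ×ˢ (Icc 1 (K0 q hsf h2))).filter (fun kl : ℕ × ℕ => Nat.Coprime kl.1 kl.2),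
    cEst (Qof (Lu q x) (aI q i)) γa = ck q hsf h2 (aI q i) kk.1 ∧ cEst (Qof (Lu q x) (bI q i)) γb = ck q hsf h2 (bI q i) kk.2

/-- **The success event of the read-out**: some usable pair carries a coprime pair of harmonics. [cite: Jozsa2003, §10 Thm. 6] -/
def GoodR (γ : Fin (nU (ofPoly q) (coreLen x)) → TIdx (Lv (ofPoly q) (coreLen x)) (Bn (ofPoly q) (coreLen x)) → Bool) : Prop :=
  ∃ i ∈ usable q (x := x), PairEv q hsf h2 i (γ (aI q i)) (γ (bI q i))

/-- The pair success bound `ε₀ = 10⁻¹³`. [folklore] -/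
def eps0 : ℝ := 1 / 10 ^ 13

/-- **A usable pair succeeds with probability `≥ ε₀`.** [cite: Jozsa2003, §10 Thm. 6 ("prob ≥ …/log")] -/
theorem prob_pairEv_ge {i : PIdx q x} (hi : i ∈ usable q (x := x)) :
    eps0 ≤ prob (X := fun _ : Fin (nU (ofPoly q) (coreLen x)) => TIdx (Lv (ofPoly q) (coreLen x)) (Bn (ofPoly q) (coreLen x)) → Bool)
      (unitLaw (Lu q x) (Ftab q x)) (univ.filter fun γ => PairEv q hsf h2 i (γ (aI q i)) (γ (bI q i))) := by
  obtain ⟨hS26, hSpos⟩ := Sx_ge q hsf h2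
  have hLm : (hallgrenW q).Lmin (coreLen x) ≤ coreLen x + i.1 := (mem_filter.1 hi).2
  obtain ⟨hLa, hLb⟩ := Lu_pair q i (x := x)
  have hLma : (hallgrenW q).Lmin (coreLen x) ≤ Lu q x (aI q i) := by rw [hLa]; exact hLm
  have hLmb : (hallgrenW q).Lmin (coreLen x) ≤ Lu q x (bI q i) := by rw [hLb]; exact hLm
  have hne : aI q i ≠ bI q i := (disjointPairs q (x := x)).a_ne_b i i
  have hq0 : (0 : ℝ) ≤ 1 / (5184 * Sx q hsf h2) := by positivity
  have h := prob_twoSamples_ge (Lv := Lv (ofPoly q) (coreLen x)) (B := Bn (ofPoly q) (coreLen x)) (Lu q x) (Ftab q x) hne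
    (K0 q hsf h2) (ck q hsf h2 (aI q i)) (ck q hsf h2 (bI q i)) (ck_injOn q hsf h2 _ hLma) (ck_injOn q hsf h2 _ hLmb) hq0 hq0
    (fun k hk => prob_unit_ge q hsf h2 _ hLma (mem_Icc.1 hk).1 (mem_Icc.1 hk).2)
    (fun k hk => prob_unit_ge q hsf h2 _ hLmb (mem_Icc.1 hk).1 (mem_Icc.1 hk).2)
  -- numerics: `K₀ ≥ S/330 − 1 ≥ S/400`, so `(K₀²/2)/(5184 S)² ≥ 1/(2 · 160000 · 5184²) ≥ 10⁻¹³`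
  have hK0 : Sx q hsf h2 / 330 - 1 ≤ (K0 q hsf h2 : ℝ) := by
    have := Nat.lt_floor_add_one (Sx q hsf h2 / 330)
    unfold K0; linarith
  have hK400 : Sx q hsf h2 / 400 ≤ (K0 q hsf h2 : ℝ) := by
    have : Sx q hsf h2 / 400 ≤ Sx q hsf h2 / 330 - 1 := by
      have h1 : (2 : ℝ) ^ 26 = 67108864 := by norm_num
      rw [h1] at hS26
      rw [div_le_iff₀ (by norm_num : (0 : ℝ) < 400)]
      nlinarith
    linarith
  set S := Sx q hsf h2 with hS
  have hK0pos : (0 : ℝ) ≤ K0 q hsf h2 := Nat.cast_nonneg _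
  have hsq : (S / 400) ^ 2 ≤ (K0 q hsf h2 : ℝ) ^ 2 := pow_le_pow_left₀ (by positivity) hK400 2
  have key : eps0 ≤ ((K0 q hsf h2 : ℝ) ^ 2 / 2) * (1 / (5184 * S) * (1 / (5184 * S))) := by
    unfold eps0
    have e : ((S / 400) ^ 2 / 2) * (1 / (5184 * S) * (1 / (5184 * S))) = 1 / (2 * 160000 * 5184 ^ 2) := by
      field_simp; ring
    calc (1 : ℝ) / 10 ^ 13 ≤ 1 / (2 * 160000 * 5184 ^ 2) := by norm_num
      _ = ((S / 400) ^ 2 / 2) * (1 / (5184 * S) * (1 / (5184 * S))) := e.symm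
      _ ≤ _ := by
          apply mul_le_mul_of_nonneg_right _ (by positivity)
          linarith
  refine key.trans (h.trans_eq ?_)
  congr 1
  ext γ
  simp only [mem_filter, mem_univ, true_and, PairEv]

/-! ### Amplification over the usable pairs -/

omit hsf h2 in
/-- `(1 − ε)^M ≤ 1/(1 + Mε)` for `0 ≤ ε ≤ 1` (Bernoulli). [folklore] -/
theorem one_sub_pow_le {ε : ℝ} (h0 : 0 ≤ ε) (h1 : ε ≤ 1) (M : ℕ) : (1 - ε) ^ M ≤ 1 / (1 + M * ε) := by
  have hB : 1 + (M : ℝ) * ε ≤ (1 + ε) ^ M := one_add_mul_le_pow (by linarith) M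
  have hpos : 0 < 1 + (M : ℝ) * ε := by positivity
  rw [le_div_iff₀ hpos]
  have h2 : (1 - ε) ^ M * (1 + ε) ^ M ≤ 1 := by
    rw [← mul_pow]
    exact pow_le_one₀ (by nlinarith) (by nlinarith)
  have h3 : 0 ≤ (1 - ε) ^ M := pow_nonneg (by linarith) M
  nlinarith

omit hsf h2 in
/-- **Many usable pairs**: if `q(n) ≥ 5n + 100 + m₀` then at least `6(m₀ + 1)` pairs are usable. [folklore] -/
theorem card_usable_ge {m₀ : ℕ} (hq : 5 * coreLen x + 100 + m₀ ≤ q.eval (coreLen x)) : 6 * (m₀ + 1) ≤ (usable q (x := x)).card := by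
  have hnL : nL (ofPoly q) (coreLen x) = q.eval (coreLen x) + 1 := rfl
  let f : Fin (m₀ + 1) × Fin 6 → PIdx q x := fun p => (⟨5 * coreLen x + 100 + p.1, by rw [hnL]; omega⟩, p.2)
  have hf : Function.Injective f := by
    intro p p' h
    simp only [f, Prod.mk.injEq, Fin.mk.injEq] at h
    exact Prod.ext (Fin.ext (by omega)) h.2
  have hmem : ∀ p, f p ∈ usable q (x := x) := by
    intro p
    simp only [usable, mem_filter, mem_univ, true_and, f]
    show 6 * coreLen x + 100 ≤ coreLen x + (5 * coreLen x + 100 + (p.1 : ℕ))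
    omega
  calc 6 * (m₀ + 1) = ((univ : Finset (Fin (m₀ + 1) × Fin 6)).image f).card := by
        rw [card_image_of_injective _ hf, card_univ, Fintype.card_prod, Fintype.card_fin, Fintype.card_fin]; ring
    _ ≤ (usable q (x := x)).card := card_le_card fun i hi => by
        obtain ⟨p, -, rfl⟩ := mem_image.1 hi; exact hmem p

/-- **The read-out succeeds with probability `≥ 3/4`** when `q(n) ≥ 5n + 100 + 5·10¹²`.
[cite: Jozsa2003, §10 Thm. 6 ("repeat … to amplify the success probability")] -/
theorem prob_goodR_ge (hq : 5 * coreLen x + 100 + 5 * 10 ^ 12 ≤ q.eval (coreLen x)) :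
    (3 : ℝ) / 4 ≤ prob (X := fun _ : Fin (nU (ofPoly q) (coreLen x)) => TIdx (Lv (ofPoly q) (coreLen x)) (Bn (ofPoly q) (coreLen x)) → Bool)
      (unitLaw (Lu q x) (Ftab q x)) (univ.filter fun γ => GoodR q hsf h2 γ) := by
  have hμ := unitLaw_isProbVec (Lv := Lv (ofPoly q) (coreLen x)) (B := Bn (ofPoly q) (coreLen x)) (Lu q x) (Ftab q x)
  have h := prob_exists_pair_ge (X := fun _ : Fin (nU (ofPoly q) (coreLen x)) => TIdx (Lv (ofPoly q) (coreLen x)) (Bn (ofPoly q) (coreLen x)) → Bool)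
    hμ (disjointPairs q (x := x)) (fun i γa γb => PairEv q hsf h2 i γa γb) (usable q (x := x)) (p := eps0)
    (fun i hi => prob_pairEv_ge q hsf h2 hi)
  have hM := card_usable_ge q hq (x := x)
  have hε0 : (0 : ℝ) ≤ eps0 := by unfold eps0; positivity
  have hε1 : eps0 ≤ 1 := by unfold eps0; norm_num
  have hpow := one_sub_pow_le hε0 hε1 (usable q (x := x)).card
  have hfrac : 1 / (1 + ((usable q (x := x)).card : ℝ) * eps0) ≤ 1 / 4 := by
    apply one_div_le_one_div_of_le (by norm_num)
    have : (6 * (5 * 10 ^ 12 + 1) : ℝ) ≤ (usable q (x := x)).card := by exact_mod_cast hM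
    unfold eps0
    nlinarith
  refine le_trans (by linarith) (h.trans_eq ?_)
  congr 1
  ext γ
  simp only [mem_filter, mem_univ, true_and, GoodR]

/-! ### The good read-out makes the post-processor correct -/

/-- **A good read-out yields `⌊R⌋` or `⌈R⌉`**: the deterministic half (`HallgrenTrueCand.result_correct_of_goodPair`)
applied to the pair and harmonics of the event. [cite: Jozsa2003, §10 (Thm. 6 and step (c))] -/
theorem result_of_goodR (y : List Bool) (hγ : GoodR q hsf h2 (readOf (ofPoly q) (coreLen x) y)) :
    result q hallgrenOps (hallgrenW q) x y = ⌊(cycD hsf h2 q x).R⌋₊ ∨ result q hallgrenOps (hallgrenW q) x y = ⌈(cycD hsf h2 q x).R⌉₊ := by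
  obtain ⟨i, hi, kk, hkk, hca, hcb⟩ := hγ
  obtain ⟨hS26, hSpos⟩ := Sx_ge q hsf h2
  have hLm : (hallgrenW q).Lmin (coreLen x) ≤ coreLen x + i.1 := (mem_filter.1 hi).2
  obtain ⟨hLa, hLb⟩ := Lu_pair q i (x := x)
  have hLma : (hallgrenW q).Lmin (coreLen x) ≤ Lu q x (aI q i) := by rw [hLa]; exact hLm
  have hLmb : (hallgrenW q).Lmin (coreLen x) ≤ Lu q x (bI q i) := by rw [hLb]; exact hLm
  rw [mem_filter, mem_product, mem_Icc, mem_Icc] at hkk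
  obtain ⟨⟨⟨hk1, hkK⟩, ⟨hl1, hlK⟩⟩, hcop⟩ := hkk
  obtain ⟨-, hck, -, hQS⟩ := ck_spec q hsf h2 (aI q i) hLma hkK
  obtain ⟨-, hcl, -, -⟩ := ck_spec q hsf h2 (bI q i) hLmb hlK
  -- the characters read by the post-processor are Kitaev's estimates
  have hLCa : LofC q (coreLen x) (aI q i) = coreLen x + i.1 := by rw [← Lu_eq, hLa]
  have hLCb : LofC q (coreLen x) (bI q i) = coreLen x + i.1 := by rw [← Lu_eq, hLb]
  have hcUa : cU q x y (aI q i) = cEst (Qof (Lu q x) (aI q i)) (readOf (ofPoly q) (coreLen x) y (aI q i)) := by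
    rw [cEst_readOf, Qof, hLa]; unfold cU; rw [hLCa]
  have hcUb : cU q x y (bI q i) = cEst (Qof (Lu q x) (bI q i)) (readOf (ofPoly q) (coreLen x) y (bI q i)) := by
    rw [cEst_readOf, Qof, hLb]; unfold cU; rw [hLCb]
  have hK0S : (K0 q hsf h2 : ℝ) ≤ Sx q hsf h2 := by
    have : (K0 q hsf h2 : ℝ) ≤ Sx q hsf h2 / 330 := Nat.floor_le (by positivity)
    linarith
  have hkS : (kk.1 : ℝ) ≤ (hallgrenW q).N x * (cycD hsf h2 q x).R := by
    have : (kk.1 : ℝ) ≤ K0 q hsf h2 := by exact_mod_cast hkK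
    exact this.trans hK0S
  have hlS : (kk.2 : ℝ) ≤ (hallgrenW q).N x * (cycD hsf h2 q x).R := by
    have : (kk.2 : ℝ) ≤ K0 q hsf h2 := by exact_mod_cast hlK
    exact this.trans hK0S
  have hQa : ((2 ^ LofC q (coreLen x) (aI q i) : ℕ) : ℝ) = (Qof (Lu q x) (aI q i) : ℝ) := by rw [hLCa, Qof, hLa]
  have hQb : ((2 ^ LofC q (coreLen x) (aI q i) : ℕ) : ℝ) = (Qof (Lu q x) (bI q i) : ℝ) := by rw [hLCa, Qof, hLb]
  refine result_correct_of_goodPair hsf h2 q rfl (aI q i).isLt (bI q i).isLt (by rw [hLCa, hLCb]) (by rw [hLCa]; exact hLm)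
    hk1 hkS hl1 hlS hcop ?_ ?_
  · rw [hcUa, hca, hQa]; exact hck
  · rw [hcUb, hcb, hQb]; exact hcl

end HallgrenGiantStep

end Literature.Computability.Cryptography

end
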